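import Summits.ResolutionOfSingularities.ResolutionOfSingularities.Theorems.PurelyInseparableDim4Directrix
import Summits.ResolutionOfSingularities.ResolutionOfSingularities.Theorems.PurelyInseparableDim4IsolatedBand
import Literature.AlgebraicGeometry.Resolution.OrdZeroBasics
import Literature.Barriers.ResolutionOfSingularities.ResidualOrderUnboundedBlowup
import HarnessLib
import HarnessLib.Audit.Tags

/-!
# Purely inseparable four-folds — the directrix letter `ē` on CLEANED states and the isolated
# regime at `(p, q) = (2, 2)` (cell `res-dim4-pi`; continues `PurelyInseparableDim4Directrix`)

[OURS · counted 0 · frame reading of the tree's directrix theory; nothing here is a new statement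
about resolution of singularities.]

* §1 `gradSpan_initialForm_ne_bot_of_isClean` — a CLEAN polynomial (no `p`-th power monomials,
  `HauserPerlega.IsClean`) of order exactly `p` has `∇(initial form) ≠ 0`; every state produced by
  the walk is clean (`isClean_step`), so the hypothesis of `Directrix` §§3–4 holds at every state of
  order `p` from index `1` on.
* §2 at `(p, q) = (2, 2)`, with p-5's ISOLATED BAND (`IsolatedBand.isolated_chain_ordZero_eq_two`:
  `ord = 2` along isolated `Step0` chains): `isolated_chain_letter_two` (from index `1` the letter
  `ē = dim A(F₂)` — the kernel of the alternating polar matrix `a_{ik} = coeff_{eᵢ+e_k} F` — is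
  antitone with values in `{1, 2, 3}`) and **`noIsolatedTrap_two_iff_no_stable_chain`**:
  F4-I(2,2) ⟺ there is no `Step0` chain of isolated `2`-fold states along which `ē` is CONSTANT
  (every edge very near, [CJS 2020] Def. 3.13 (2)).

Census note (p-12 LOCATE, desk frame v4): at `(2, 2)` the constant value is the case `ē = 2` which
[CJS 2020] Thms 6.35/6.40 treat only under `char k(x) ≥ dim X/2 + 1 = 3` — F4-I(2,2) sits exactly
outside that hypothesis.  Nothing here proves `NoIsolatedTrap 2 2` or resolution of singularities in
dimension ≥ 4 / characteristic `p`.  bears_on: LADDER-RESOLUTION:D157-DOOR2 (res-dim4-pi · polar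
lemma).  Supports stmt-ResolutionOfSingularities-16155 (helper).
-/

set_option linter.dupNamespace false

noncomputable section

namespace Summit.ResolutionOfSingularities.ResolutionOfSingularities.Theorems.PIDim4

namespace Directrix

open MvPolynomial Finset
open Literature.AlgebraicGeometry.Resolution
open Literature.AlgebraicGeometry.Resolution.Hauser2010
open Literature.AlgebraicGeometry.Resolution.HauserPerlega2019
open Literature.Barriers.ResolutionOfSingularities
open PointBlowup (direction AdditiveAlong gradSpan additiveSubspace polarMap)

variable {K : Type} [Field K]

/-! ## 1. Cleaned states of order `p` have `∇ ≠ 0` -/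

section Clean

/-- **A CLEAN polynomial of order exactly `p` has `∇(initial form) ≠ 0`**: its initial form has a
monomial `x^d`, `|d| = p`, with some `p ∤ dᵢ`, and then `∂ᵢ` of it is non-zero. So every state
PRODUCED by the walk (`step` cleans) satisfies the hypothesis of §§3–4 as soon as its order is `p`.
[cite: Hauser2010, §F (cleaning)] [folklore] -/
theorem gradSpan_initialForm_ne_bot_of_isClean (p : ℕ) [Fact p.Prime] [CharP K p]
    {F : MvPolynomial (Fin 4) K} (hord : ordZero F = p) (hclean : HauserPerlega.IsClean p F) :
    gradSpan (initialForm F) ≠ ⊥ := by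
  classical
  have hp : p.Prime := Fact.out
  rw [initialForm_eq_homogeneousComponent hord]
  set Φ := homogeneousComponent p F with hΦ
  have hΦne : Φ ≠ 0 := homogeneousComponent_ne_zero_of_ordZero_eq hord
  obtain ⟨d, hd⟩ := MvPolynomial.ne_zero_iff.mp hΦne
  have hdF : coeff d F ≠ 0 ∧ d.degree = p := by
    rw [hΦ, coeff_homogeneousComponent] at hd
    split_ifs at hd with hdeg
    · exact ⟨hd, hdeg⟩
    · exact absurd rfl hd
  have hnot : ¬ IsPthPowerExponent p d := hclean d (MvPolynomial.mem_support_iff.mpr hdF.1)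
  obtain ⟨i, hi, hpi⟩ : ∃ i ∈ d.support, ¬ p ∣ d i := by
    by_contra hcon
    push Not at hcon
    exact hnot hcon
  have hdi : 1 ≤ d i := Nat.one_le_iff_ne_zero.mpr (Finsupp.mem_support_iff.mp hi)
  -- the coefficient of `x^{d - eᵢ}` in `∂ᵢ Φ` is `dᵢ · coeff_d Φ ≠ 0`
  have hcoeff : coeff (d - Finsupp.single i 1) (pderiv i Φ) ≠ 0 := by
    rw [coeff_pderiv, tsub_add_cancel_of_le (Finsupp.single_le_iff.mpr (by simpa using hdi))]
    have h1 : (((d - Finsupp.single i 1 : Fin 4 →₀ ℕ) i : ℕ) : K) + 1 = (d i : K) := by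
      rw [Finsupp.tsub_apply, Finsupp.single_eq_same, ← Nat.cast_succ]
      exact congrArg (fun n : ℕ => (n : K)) (Nat.sub_add_cancel hdi)
    rw [h1]
    refine mul_ne_zero hd ?_
    rwa [Ne, CharP.cast_eq_zero_iff K p]
  have hne : pderiv i Φ ≠ 0 := fun h => hcoeff (by rw [h, coeff_zero])
  intro hbot
  have hmem : pderiv i Φ ∈ gradSpan Φ := Submodule.subset_span ⟨i, rfl⟩
  rw [hbot, Submodule.mem_bot] at hmem
  exact hne hmem

variable [DecidableEq K]

/-- The residual polynomial after a step of the walk is clean. [cite: Hauser2010, §F (cleaning)] -/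
theorem isClean_step (q : ℕ) (S : Finset (Fin 4)) (j : Fin 4) (b : Fin 4 → K) (s : State K) :
    HauserPerlega.IsClean q (CentreBlowup.step q S j b s).F :=
  HauserPerlega.isClean_deletePthPowers q _

end Clean

/-! ## 2. The isolated regime at `(p, q) = (2, 2)` -/

section Two

variable [DecidableEq K]

/-- **The isolated regime at `(p, q) = (2, 2)`, census letter.** Along every `Step0` chain of ISOLATED
`2`-fold states in characteristic `2`: every state has order `2` (p-5's ISOLATED BAND
`IsolatedBand.isolated_chain_ordZero_eq_two`), every state from index `1` on is clean with `∇ ≠ 0`,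
and from index `1` on the letter `ē = dim A(F₂)` (kernel of the alternating polar matrix) is
antitone with values in `{1, 2, 3}`. [OURS · frame reading] [cite: CossartJannsenSaito2020, Thm. 3.10 (4)] -/
theorem isolated_chain_letter_two [CharP K 2] {c : ℕ → State K}
    (hc : ∀ k, IsIsolated 2 (c k).F ∧ Step0 2 (c k) (c (k + 1))) :
    (∀ k, ordZero (c k).F = 2) ∧
      (∀ k, gradSpan (initialForm (c (k + 1)).F) ≠ ⊥) ∧
      Antitone (fun k => Module.finrank K (additiveSubspace (initialForm (c (k + 1)).F))) ∧
      ∀ k, 1 ≤ Module.finrank K (additiveSubspace (initialForm (c (k + 1)).F)) ∧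
        Module.finrank K (additiveSubspace (initialForm (c (k + 1)).F)) ≤ 3 := by
  have hord : ∀ k, ordZero (c k).F = 2 := IsolatedBand.isolated_chain_ordZero_eq_two hc
  have hclean : ∀ k, HauserPerlega.IsClean 2 (c (k + 1)).F := fun k => by
    obtain ⟨-, j, b, -, -, -, -, hck⟩ := (hc k).2
    rw [hck]
    exact isClean_step 2 _ j b (c k)
  have hgrad : ∀ k, gradSpan (initialForm (c (k + 1)).F) ≠ ⊥ := fun k =>
    gradSpan_initialForm_ne_bot_of_isClean 2 (hord (k + 1)) (hclean k)
  have hc' : ∀ k, Step0 2 (c (k + 1)) (c (k + 1 + 1)) := fun k => (hc (k + 1)).2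
  exact ⟨hord, hgrad, step0_chain_antitone 2 (fun k => c (k + 1)) hc' (hord 1) (hgrad 0),
    step0_chain_letter_bounds 2 (fun k => c (k + 1)) hc' (hord 1) (hgrad 0)⟩

/-- **F4-I at `(2, 2)` reduces to `ē`-STABLE chains**: `NoIsolatedTrap 2 2` holds iff there is no
`Step0` chain of isolated `2`-fold states along which `ē` is CONSTANT (with value in `{1, 2, 3}`; on
such a chain every edge is very near in the sense of [CJS 2020] Def. 3.13 (2)).  (⇒ is trivial; ⇐:
shift any isolated chain to the tail on which the antitone letter has stabilised.)
[OURS · frame reading] [cite: CossartJannsenSaito2020, Def. 3.13 (2) and Thm. 3.10 (4)] -/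
theorem noIsolatedTrap_two_iff_no_stable_chain :
    NoIsolatedTrap 2 2 ↔ ∀ (K : Type) [Field K] [CharP K 2] [DecidableEq K],
      ¬ ∃ (c : ℕ → State K) (e : ℕ), 1 ≤ e ∧ e ≤ 3 ∧ ∀ k, IsIsolated 2 (c k).F ∧
        Step0 2 (c k) (c (k + 1)) ∧ ordZero (c k).F = 2 ∧
        Module.finrank K (additiveSubspace (initialForm (c k).F)) = e := by
  constructor
  · intro h K _ _ _
    rintro ⟨c, e, -, -, hc⟩
    exact h K ⟨c, fun k => ⟨(hc k).1, (hc k).2.1⟩⟩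
  · intro h K _ _ _
    rintro ⟨c, hc⟩
    obtain ⟨hord, hgrad, -, -⟩ := isolated_chain_letter_two hc
    have hc' : ∀ k, Step0 2 (c (k + 1)) (c (k + 1 + 1)) := fun k => (hc (k + 1)).2
    obtain ⟨N, e, h1, h3, hN⟩ :=
      step0_chain_eventually_constant 2 (fun k => c (k + 1)) hc' (hord 1) (hgrad 0)
    refine h K ⟨fun k => c (k + 1 + N), e, h1, h3, fun k => ⟨(hc _).1, ?_, hord _, ?_⟩⟩
    · have := (hc (k + 1 + N)).2
      rwa [show k + 1 + N + 1 = k + 1 + 1 + N by ring] at this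
    · have := hN (k + N) (Nat.le_add_left N k)
      rwa [show k + N + 1 = k + 1 + N by ring] at this

end Two

end Directrix

end Summit.ResolutionOfSingularities.ResolutionOfSingularities.Theorems.PIDim4

end
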